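import Mathlib
import HarnessLib
import Literature.MathematicalPhysics.QuantumLattice.GrassmannGaussianQuadraticInsertion
import Literature.MathematicalPhysics.QuantumLattice.GrassmannPairLaplacians
import Summits.HubbardSuperconductivity.HubbardSuperconductivity.Theorems.KLProgrammeKLRegimeVolumeLimitFrameReduction
import Summits.HubbardSuperconductivity.HubbardSuperconductivity.Theorems.KLProgrammeKLRegimeVolumeLimitDyson
import Summits.HubbardSuperconductivity.HubbardSuperconductivity.Theorems.KLProgrammeKLRegimeVolumeLimitSecondOrderWick

/-!
# Child `KLRegimeVolumeLimit` (stmt-HubbardSuperconductivity-19826 `KLRegimeVolumeLimitV11` / its gen-4 twin) — the finite-`M`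
# Schwinger–Dyson form of the volume-limit carrier RESOLVED IN THE COUPLING: bare reduction, the occupation term, and the
# cancellation of the re-amputation growth (every `U`, every frame, every finite `(β, L, M)`; seat hubbard-kl-k3c5-p3,
# technique «OS-positivity-free direct assembly»)

The carrier of `FinalTwoLegVolLimit β U μ K Mstar` is `Σ̂^K_{L,M} = klSelfEnergy L M β U μ K klE0 (nScales β + 1)`.  k3c5-p2's
`…VolumeLimitDyson` (`gaussExpect_genPair_dyson`, two Grassmann integrations by parts, ANY even nilpotent `V`) and the frame reduction
`βL² ĝ_K² Σ̂^K = N/D + βL² ĝ_K` (`…VolumeLimitFrameReduction`) are combined here at the BARE interaction `V(U) = U·W` (`W = V(1)`),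
where `∂V = U ∂W` separates the two insertions by their order in `U`:

  `N(k,σ;U) + βL² ĝ₀(k) D(U) = (βL² ĝ₀(k))² · ( −U · a + U² · b(k,σ) )`,
  `a := ∫dμ_C e^{−V(U)} ∂⁺_{kσ}∂⁻_{kσ}W`,  `b(k,σ) := ∫dμ_C e^{−V(U)} (∂⁺_{kσ}W)(∂⁻_{kσ}W)`

(`twoPoint_add_eq_schwingerDyson`; `N = ∫dμ_C ψ̂⁺_{kσ}ψ̂⁻_{kσ}e^{−V}`, `D = ∫dμ_C e^{−V}` bare and frame-free).  Proved consequences: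
* `§3` `a = −(βL²)⁻³ Σ_q N(q,σ̄;U)` — the OPPOSITE-SPIN OCCUPATION SUM (`∂⁺∂⁻W` is the opposite-spin density, `…SecondOrderWick`); in
  particular the order-`U` insertion is THE SAME at every external label `k` (`gaussExpect_boltzmann_dd_eq`, `…_of_label`);
* `§4` solved forms for `D(U) ≠ 0`: in the bare frame `Σ̂⁰(k,σ) = βL²(−U·a + U²·b(k,σ))/D` — the growth `ĝ₀(k)⁻² ∼ ω²` of the
  re-amputation has CANCELLED at finite `M`, with no positivity used (`selfEnergy_fullActionCT_bare_eq_schwingerDyson`,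
  `norm_selfEnergy_bare_le_schwingerDyson`); in any frame `Σ̂^K = (ĝ₀/ĝ_K)²·Σ̂⁰ + (ĝ_K − ĝ₀)/ĝ_K²` — the frame enters only through the
  bounded zero-coupling dressing `ĝ₀/ĝ_K = 1 + K·ĝ₀` (`selfEnergy_fullActionCT_eq_schwingerDyson`);
* `§5` the same for the carrier `klSelfEnergy … (nScales β + 1)` (`β > 0`); `§6` `Σ̂⁰ = U·(βL²)⁻²Σ_q N(q,σ̄)/D + U²·βL²·b(k,σ)/D`.
READING (TAU-BRIDGE.md §3 (U), HOME/hubbard-kl-k3c5-p2): this is the Grassmann twin of the Hamiltonian Dyson form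
`(ĝ − 𝒢)(−ik₀+ξ)² = U⟨{T,c†}⟩ − U²𝒵` (`…ThermalGreenHubbardTorusExact`); clause (i) of the VL text at finite `M` is thereby a bound on
ONE scalar occupation ratio (label-free) and ONE six-point insertion `b(k,σ)/D`, with no frequency weight left — what carries it to the
`L`-uniform `M = ∞` bound is the τ-resolved all-`U` Matsubara limit of these two insertions.  Everything is proved; no definition.
-/

noncomputable section

namespace Summit.HubbardSuperconductivity.HubbardSuperconductivity.Theorems.TwoPointAssembly

set_option linter.dupNamespace false -- summit = problem name (single-conjunct summit), D-0017

open Finset Literature.MathematicalPhysics.QuantumLattice Literature.Probability.LatticeModels GrassmannAlgebra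
open Summit.HubbardSuperconductivity.HubbardSuperconductivity.Theorems.KLRegimeSplit
open Summit.HubbardSuperconductivity.HubbardSuperconductivity.Theorems.KLProgrammeLegKernels

variable {L M : ℕ} [NeZero L]

/-! ## §1 The Boltzmann factor `e^{−V(U)}` and the coupling-linearity of `∂V` -/

/-- `e^{−V(U)}` is even. -/
theorem boltzmann_mem_evenOdd_zero (β U : ℝ) : grassmannExp (-(hubbardInteraction L M β U)) ∈ evenOdd ℂ 0 :=
  grassmannExp_mem_evenOdd_zero ℂ (neg_mem (hubbardInteraction_mem_evenOdd_zero L M β U))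
    (isNilpotent_of_constPart_eq_zero ℂ (by rw [map_neg, constPart_hubbardInteraction, neg_zero]))

/-- `∂_X V(U) = U · ∂_X W` (`W = V(1)`). -/
theorem grassmannDeriv_hubbardInteraction_eq_smul (β U : ℝ) (X : HubbardFieldIdx L M) :
    grassmannDeriv ℂ X (hubbardInteraction L M β U) = (U : ℂ) • grassmannDeriv ℂ X (hubbardInteraction L M β 1) := by
  rw [hubbardInteraction_eq_smul_one β U, map_smul]

/-! ## §2 The double Schwinger–Dyson identity, resolved in the coupling -/

/-- **THE DOUBLE SCHWINGER–DYSON IDENTITY, `U`-RESOLVED** (every `U`, every finite `(L, M)`, `β ≠ 0`; no hypothesis on `D(U)`):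
`N(k,σ;U) + βL² ĝ₀(k) D(U) = (βL² ĝ₀(k))² · ( −U · ∫dμ_C e^{−V(U)} ∂⁺_{kσ}∂⁻_{kσ}W + U² · ∫dμ_C e^{−V(U)} (∂⁺_{kσ}W)(∂⁻_{kσ}W) )`
— k3c5-p2's `gaussExpect_genPair_dyson` (any even nilpotent `V`, `…VolumeLimitDyson`) at the bare interaction `V(U) = U·W` in the frame `0`,
with the two insertions separated by their order in `U`. -/
theorem twoPoint_add_eq_schwingerDyson {β : ℝ} (hβ : β ≠ 0) (U μ : ℝ) (k : FreqMomentum L M) (σ : Fin 2) :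
    gaussExpect ℂ (hubbardCovariance L M β μ 0)
          (gen ℂ (((k, σ), 0) : HubbardFieldIdx L M) * gen ℂ (((k, σ), 1) : HubbardFieldIdx L M) *
            grassmannExp (-(hubbardInteraction L M β U))) +
        ((β * (L : ℝ) ^ 2 : ℝ) : ℂ) * propCT L M β μ 0 k *
          effPartitionFn ℂ (hubbardCovariance L M β μ 0) (hubbardInteraction L M β U) =
      (((β * (L : ℝ) ^ 2 : ℝ) : ℂ) * propCT L M β μ 0 k) ^ 2 *
        (-(U : ℂ) *
            gaussExpect ℂ (hubbardCovariance L M β μ 0)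
              (grassmannExp (-(hubbardInteraction L M β U)) *
                grassmannDeriv ℂ (((k, σ), 0) : HubbardFieldIdx L M)
                  (grassmannDeriv ℂ (((k, σ), 1) : HubbardFieldIdx L M) (hubbardInteraction L M β 1))) +
          (U : ℂ) ^ 2 *
            gaussExpect ℂ (hubbardCovariance L M β μ 0)
              (grassmannExp (-(hubbardInteraction L M β U)) *
                (grassmannDeriv ℂ (((k, σ), 0) : HubbardFieldIdx L M) (hubbardInteraction L M β 1) *
                  grassmannDeriv ℂ (((k, σ), 1) : HubbardFieldIdx L M) (hubbardInteraction L M β 1)))) := by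
  have hdy := gaussExpect_genPair_dyson hβ μ 0 k σ (hubbardInteraction_mem_evenOdd_zero L M β U)
    (isNilpotent_hubbardInteraction L M β U)
  rw [hubbardCovarianceCT_zero_frame, ← effPartitionFn_eq_gaussExpect, grassmannDeriv_hubbardInteraction_eq_smul β U,
    grassmannDeriv_hubbardInteraction_eq_smul β U, map_smul, smul_mul_assoc,
    mul_smul_comm, smul_smul, mul_sub, mul_smul_comm, mul_smul_comm, map_sub, map_smul, map_smul, smul_eq_mul, smul_eq_mul] at hdy
  rw [hdy]
  ring

/-! ## §3 The first insertion is the opposite-spin occupation sum (independent of the external label) -/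

/-- `e^{−V(U)}` commutes with everything (it is even). -/
theorem boltzmann_comm (β U : ℝ) (x : HubbardGrassmann L M) :
    grassmannExp (-(hubbardInteraction L M β U)) * x = x * grassmannExp (-(hubbardInteraction L M β U)) :=
  (commute_of_mem_evenOdd_zero ℂ (boltzmann_mem_evenOdd_zero (L := L) (M := M) β U) x).eq

/-- Pulling the Boltzmann factor through a scalar multiple of an occupation sum. -/
theorem gaussExpect_boltzmann_mul_smul_sum_pair (β U μ : ℝ) (r : ℂ) (τ : Fin 2) :
    gaussExpect ℂ (hubbardCovariance L M β μ 0)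
        (grassmannExp (-(hubbardInteraction L M β U)) * (r • ∑ q : FreqMomentum L M, psiPlus q τ * psiMinus q τ)) =
      r * ∑ q : FreqMomentum L M,
        gaussExpect ℂ (hubbardCovariance L M β μ 0)
          (gen ℂ (((q, τ), 0) : HubbardFieldIdx L M) * gen ℂ (((q, τ), 1) : HubbardFieldIdx L M) *
            grassmannExp (-(hubbardInteraction L M β U))) := by
  rw [mul_smul_comm, map_smul, Finset.mul_sum, map_sum, smul_eq_mul]
  congr 1
  refine Finset.sum_congr rfl fun q _ => ?_
  rw [boltzmann_comm]
  rfl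

/-- **`∫dμ_C e^{−V(U)} ∂⁺_{kσ}∂⁻_{kσ}W = −(βL²)⁻³ Σ_q N(q, σ̄; U)`** — the opposite-spin occupation sum (`σ̄ = 1 − σ`); in particular it
does not depend on the external label `k`. -/
theorem gaussExpect_boltzmann_dd_eq (β U μ : ℝ) (k : FreqMomentum L M) (σ : Fin 2) :
    gaussExpect ℂ (hubbardCovariance L M β μ 0)
        (grassmannExp (-(hubbardInteraction L M β U)) *
          grassmannDeriv ℂ (((k, σ), 0) : HubbardFieldIdx L M)
            (grassmannDeriv ℂ (((k, σ), 1) : HubbardFieldIdx L M) (hubbardInteraction L M β 1))) =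
      -((((1 / (β * (L : ℝ) ^ 2) ^ 3 : ℝ) : ℂ)) *
        ∑ q : FreqMomentum L M,
          gaussExpect ℂ (hubbardCovariance L M β μ 0)
            (gen ℂ (((q, 1 - σ), 0) : HubbardFieldIdx L M) * gen ℂ (((q, 1 - σ), 1) : HubbardFieldIdx L M) *
              grassmannExp (-(hubbardInteraction L M β U)))) := by
  fin_cases σ
  · simp only [Fin.zero_eta, Fin.isValue, sub_zero, dd_up_hubbardInteraction, mul_neg, map_neg,
      gaussExpect_boltzmann_mul_smul_sum_pair]
  · simp only [Fin.mk_one, Fin.isValue, sub_self, dd_down_hubbardInteraction, mul_neg, map_neg,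
      gaussExpect_boltzmann_mul_smul_sum_pair]

/-- Hence the first insertion is the same at every external label. -/
theorem gaussExpect_boltzmann_dd_eq_of_label (β U μ : ℝ) (k k' : FreqMomentum L M) (σ : Fin 2) :
    gaussExpect ℂ (hubbardCovariance L M β μ 0)
        (grassmannExp (-(hubbardInteraction L M β U)) *
          grassmannDeriv ℂ (((k, σ), 0) : HubbardFieldIdx L M)
            (grassmannDeriv ℂ (((k, σ), 1) : HubbardFieldIdx L M) (hubbardInteraction L M β 1))) =
      gaussExpect ℂ (hubbardCovariance L M β μ 0)
        (grassmannExp (-(hubbardInteraction L M β U)) *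
          grassmannDeriv ℂ (((k', σ), 0) : HubbardFieldIdx L M)
            (grassmannDeriv ℂ (((k', σ), 1) : HubbardFieldIdx L M) (hubbardInteraction L M β 1))) := by
  rw [gaussExpect_boltzmann_dd_eq, gaussExpect_boltzmann_dd_eq]

/-! ## §4 Solved forms: the frequency growth of the re-amputation cancels at finite `M` -/

/-- **Frame reduction + double Schwinger–Dyson** (every frame `K`, `D(U) ≠ 0`, `β ≠ 0`):
`βL² ĝ_K(k)² Σ̂^K(k,σ) = (βL² ĝ₀(k))² (−U·a + U²·b(k,σ))/D + βL² (ĝ_K(k) − ĝ₀(k))`, with the two insertions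
`a = ∫dμ_C e^{−V} ∂⁺_{kσ}∂⁻_{kσ}W`, `b(k,σ) = ∫dμ_C e^{−V} (∂⁺_{kσ}W)(∂⁻_{kσ}W)`. -/
theorem selfEnergy_fullActionCT_frame_schwingerDyson {β : ℝ} (hβ : β ≠ 0) (U μ : ℝ) (K : TrigPolyC4v) (k : FreqMomentum L M)
    (σ : Fin 2) (hD : effPartitionFn ℂ (hubbardCovariance L M β μ 0) (hubbardInteraction L M β U) ≠ 0) :
    ((β * (L : ℝ) ^ 2 : ℝ) : ℂ) * propCT L M β μ K k ^ 2 * selfEnergy L M β (fullActionCT L M β U μ K) k σ =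
      (((β * (L : ℝ) ^ 2 : ℝ) : ℂ) * propCT L M β μ 0 k) ^ 2 *
          (-(U : ℂ) *
              gaussExpect ℂ (hubbardCovariance L M β μ 0)
                (grassmannExp (-(hubbardInteraction L M β U)) *
                  grassmannDeriv ℂ (((k, σ), 0) : HubbardFieldIdx L M)
                    (grassmannDeriv ℂ (((k, σ), 1) : HubbardFieldIdx L M) (hubbardInteraction L M β 1))) +
            (U : ℂ) ^ 2 *
              gaussExpect ℂ (hubbardCovariance L M β μ 0)
                (grassmannExp (-(hubbardInteraction L M β U)) *
                  (grassmannDeriv ℂ (((k, σ), 0) : HubbardFieldIdx L M) (hubbardInteraction L M β 1) *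
                    grassmannDeriv ℂ (((k, σ), 1) : HubbardFieldIdx L M) (hubbardInteraction L M β 1)))) /
          effPartitionFn ℂ (hubbardCovariance L M β μ 0) (hubbardInteraction L M β U) +
        ((β * (L : ℝ) ^ 2 : ℝ) : ℂ) * (propCT L M β μ K k - propCT L M β μ 0 k) := by
  rw [selfEnergy_fullActionCT_frame_reduction hβ U μ K k σ hD, ← twoPoint_add_eq_schwingerDyson hβ U μ k σ]
  field_simp
  ring

/-- **Bare frame, solved**: for `D(U) ≠ 0`,
`Σ̂⁰(k,σ) = βL² · (−U·a + U²·b(k,σ)) / D` — NO factor `ĝ₀(k)⁻² ∼ ω²`: the re-amputation growth has cancelled exactly. -/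
theorem selfEnergy_fullActionCT_bare_eq_schwingerDyson {β : ℝ} (hβ : β ≠ 0) (U μ : ℝ) (k : FreqMomentum L M) (σ : Fin 2)
    (hD : effPartitionFn ℂ (hubbardCovariance L M β μ 0) (hubbardInteraction L M β U) ≠ 0) :
    selfEnergy L M β (fullActionCT L M β U μ 0) k σ =
      ((β * (L : ℝ) ^ 2 : ℝ) : ℂ) *
          (-(U : ℂ) *
              gaussExpect ℂ (hubbardCovariance L M β μ 0)
                (grassmannExp (-(hubbardInteraction L M β U)) *
                  grassmannDeriv ℂ (((k, σ), 0) : HubbardFieldIdx L M)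
                    (grassmannDeriv ℂ (((k, σ), 1) : HubbardFieldIdx L M) (hubbardInteraction L M β 1))) +
            (U : ℂ) ^ 2 *
              gaussExpect ℂ (hubbardCovariance L M β μ 0)
                (grassmannExp (-(hubbardInteraction L M β U)) *
                  (grassmannDeriv ℂ (((k, σ), 0) : HubbardFieldIdx L M) (hubbardInteraction L M β 1) *
                    grassmannDeriv ℂ (((k, σ), 1) : HubbardFieldIdx L M) (hubbardInteraction L M β 1)))) /
        effPartitionFn ℂ (hubbardCovariance L M β μ 0) (hubbardInteraction L M β U) := by
  have hβL : ((β * (L : ℝ) ^ 2 : ℝ) : ℂ) ≠ 0 := by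
    have hL : (L : ℝ) ≠ 0 := by exact_mod_cast NeZero.ne L
    exact_mod_cast mul_ne_zero hβ (pow_ne_zero 2 hL)
  have hg := propCT_ne_zero (L := L) (M := M) hβ μ 0 k
  have h := selfEnergy_fullActionCT_frame_schwingerDyson hβ U μ 0 k σ hD
  rw [sub_self, mul_zero, add_zero] at h
  have hc : ((β * (L : ℝ) ^ 2 : ℝ) : ℂ) * propCT L M β μ 0 k ^ 2 ≠ 0 := mul_ne_zero hβL (pow_ne_zero 2 hg)
  calc selfEnergy L M β (fullActionCT L M β U μ 0) k σ
      = (((β * (L : ℝ) ^ 2 : ℝ) : ℂ) * propCT L M β μ 0 k ^ 2 * selfEnergy L M β (fullActionCT L M β U μ 0) k σ) /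
          (((β * (L : ℝ) ^ 2 : ℝ) : ℂ) * propCT L M β μ 0 k ^ 2) := by field_simp
    _ = _ := by rw [h]; field_simp

/-- **Every frame, solved**: for `D(U) ≠ 0`,
`Σ̂^K(k,σ) = (ĝ₀(k)/ĝ_K(k))² · βL² (−U·a + U²·b(k,σ))/D + (ĝ_K(k) − ĝ₀(k))/ĝ_K(k)²` — the frame enters only through the bounded
zero-coupling dressing `ĝ₀/ĝ_K = 1 + K·ĝ₀` and the explicit additive term. -/
theorem selfEnergy_fullActionCT_eq_schwingerDyson {β : ℝ} (hβ : β ≠ 0) (U μ : ℝ) (K : TrigPolyC4v) (k : FreqMomentum L M)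
    (σ : Fin 2) (hD : effPartitionFn ℂ (hubbardCovariance L M β μ 0) (hubbardInteraction L M β U) ≠ 0) :
    selfEnergy L M β (fullActionCT L M β U μ K) k σ =
      (propCT L M β μ 0 k / propCT L M β μ K k) ^ 2 * selfEnergy L M β (fullActionCT L M β U μ 0) k σ +
        (propCT L M β μ K k - propCT L M β μ 0 k) / propCT L M β μ K k ^ 2 := by
  have hβL : ((β * (L : ℝ) ^ 2 : ℝ) : ℂ) ≠ 0 := by
    have hL : (L : ℝ) ≠ 0 := by exact_mod_cast NeZero.ne L
    exact_mod_cast mul_ne_zero hβ (pow_ne_zero 2 hL)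
  have hgK := propCT_ne_zero (L := L) (M := M) hβ μ K k
  have hK := selfEnergy_fullActionCT_frame_schwingerDyson hβ U μ K k σ hD
  have h0 := selfEnergy_fullActionCT_frame_schwingerDyson hβ U μ 0 k σ hD
  rw [sub_self, mul_zero, add_zero] at h0
  rw [← h0] at hK
  have hc : ((β * (L : ℝ) ^ 2 : ℝ) : ℂ) * propCT L M β μ K k ^ 2 ≠ 0 := mul_ne_zero hβL (pow_ne_zero 2 hgK)
  calc selfEnergy L M β (fullActionCT L M β U μ K) k σ
      = (((β * (L : ℝ) ^ 2 : ℝ) : ℂ) * propCT L M β μ K k ^ 2 * selfEnergy L M β (fullActionCT L M β U μ K) k σ) /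
          (((β * (L : ℝ) ^ 2 : ℝ) : ℂ) * propCT L M β μ K k ^ 2) := by field_simp
    _ = _ := by rw [hK]; field_simp

/-- **The bare two-leg kernel has no frequency growth at finite `M` (OS-positivity-free):**
`‖Σ̂⁰(k,σ)‖ ≤ βL² · (|U|·‖a‖ + U²·‖b(k,σ)‖) / ‖D‖` whenever `D(U) ≠ 0` (`β ≠ 0`; `‖βL²‖ = |β| L²`). -/
theorem norm_selfEnergy_bare_le_schwingerDyson {β : ℝ} (hβ : β ≠ 0) (U μ : ℝ) (k : FreqMomentum L M) (σ : Fin 2)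
    (hD : effPartitionFn ℂ (hubbardCovariance L M β μ 0) (hubbardInteraction L M β U) ≠ 0) :
    ‖selfEnergy L M β (fullActionCT L M β U μ 0) k σ‖ ≤
      |β| * (L : ℝ) ^ 2 *
          (|U| *
              ‖gaussExpect ℂ (hubbardCovariance L M β μ 0)
                  (grassmannExp (-(hubbardInteraction L M β U)) *
                    grassmannDeriv ℂ (((k, σ), 0) : HubbardFieldIdx L M)
                      (grassmannDeriv ℂ (((k, σ), 1) : HubbardFieldIdx L M) (hubbardInteraction L M β 1)))‖ +
            U ^ 2 *
              ‖gaussExpect ℂ (hubbardCovariance L M β μ 0)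
                  (grassmannExp (-(hubbardInteraction L M β U)) *
                    (grassmannDeriv ℂ (((k, σ), 0) : HubbardFieldIdx L M) (hubbardInteraction L M β 1) *
                      grassmannDeriv ℂ (((k, σ), 1) : HubbardFieldIdx L M) (hubbardInteraction L M β 1)))‖) /
        ‖effPartitionFn ℂ (hubbardCovariance L M β μ 0) (hubbardInteraction L M β U)‖ := by
  rw [selfEnergy_fullActionCT_bare_eq_schwingerDyson hβ U μ k σ hD, norm_div, norm_mul]
  have hc : ‖((β * (L : ℝ) ^ 2 : ℝ) : ℂ)‖ = |β| * (L : ℝ) ^ 2 := by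
    rw [Complex.norm_real, Real.norm_eq_abs, abs_mul, abs_pow, Nat.abs_cast]
  rw [hc]
  gcongr
  refine (norm_add_le _ _).trans (add_le_add ?_ ?_)
  · rw [norm_mul, norm_neg, Complex.norm_real, Real.norm_eq_abs]
  · rw [norm_mul, norm_pow, Complex.norm_real, Real.norm_eq_abs, sq_abs]

/-! ## §5 The carrier of the volume-limit text: `klSelfEnergy … (nScales β + 1)` -/

/-- For `β > 0` the VL carrier IS the two-leg kernel of the fully integrated countertermed action. -/
theorem klSelfEnergy_nScales_succ_eq_selfEnergy_fullActionCT {β : ℝ} (hβ : 0 < β) (U μ : ℝ) (K : TrigPolyC4v)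
    (k : FreqMomentum L M) (σ : Fin 2) :
    klSelfEnergy L M β U μ K klE0 (nScales β + 1) k σ = selfEnergy L M β (fullActionCT L M β U μ K) k σ := by
  rw [klSelfEnergy, klEffectiveAction_nScales_succ L M hβ, ← fullActionCT]

/-- **The VL carrier in the double Schwinger–Dyson form** (every frame, `β > 0`, `D(U) ≠ 0`):
`Σ̂^K_{L,M}(k,σ) = (ĝ₀/ĝ_K)(k)² · Σ̂⁰_{L,M}(k,σ) + (ĝ_K − ĝ₀)(k)/ĝ_K(k)²` with the bare kernel
`Σ̂⁰_{L,M}(k,σ) = βL²(−U·a + U²·b(k,σ))/D` of `selfEnergy_fullActionCT_bare_eq_schwingerDyson`. -/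
theorem klSelfEnergy_nScales_succ_eq_schwingerDyson {β : ℝ} (hβ : 0 < β) (U μ : ℝ) (K : TrigPolyC4v) (k : FreqMomentum L M)
    (σ : Fin 2) (hD : effPartitionFn ℂ (hubbardCovariance L M β μ 0) (hubbardInteraction L M β U) ≠ 0) :
    klSelfEnergy L M β U μ K klE0 (nScales β + 1) k σ =
      (propCT L M β μ 0 k / propCT L M β μ K k) ^ 2 *
          (((β * (L : ℝ) ^ 2 : ℝ) : ℂ) *
              (-(U : ℂ) *
                  gaussExpect ℂ (hubbardCovariance L M β μ 0)
                    (grassmannExp (-(hubbardInteraction L M β U)) *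
                      grassmannDeriv ℂ (((k, σ), 0) : HubbardFieldIdx L M)
                        (grassmannDeriv ℂ (((k, σ), 1) : HubbardFieldIdx L M) (hubbardInteraction L M β 1))) +
                (U : ℂ) ^ 2 *
                  gaussExpect ℂ (hubbardCovariance L M β μ 0)
                    (grassmannExp (-(hubbardInteraction L M β U)) *
                      (grassmannDeriv ℂ (((k, σ), 0) : HubbardFieldIdx L M) (hubbardInteraction L M β 1) *
                        grassmannDeriv ℂ (((k, σ), 1) : HubbardFieldIdx L M) (hubbardInteraction L M β 1)))) /
            effPartitionFn ℂ (hubbardCovariance L M β μ 0) (hubbardInteraction L M β U)) +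
        (propCT L M β μ K k - propCT L M β μ 0 k) / propCT L M β μ K k ^ 2 := by
  rw [klSelfEnergy_nScales_succ_eq_selfEnergy_fullActionCT hβ, selfEnergy_fullActionCT_eq_schwingerDyson hβ.ne' U μ K k σ hD,
    selfEnergy_fullActionCT_bare_eq_schwingerDyson hβ.ne' U μ k σ hD]

/-- **The bare VL carrier has no frequency growth at finite `M`**: for `β > 0` and `D(U) ≠ 0`,
`‖klSelfEnergy L M β U μ 0 klE0 (nScales β + 1) k σ‖ ≤ βL²(|U|‖a‖ + U²‖b(k,σ)‖)/‖D‖`. -/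
theorem norm_klSelfEnergy_nScales_succ_bare_le {β : ℝ} (hβ : 0 < β) (U μ : ℝ) (k : FreqMomentum L M) (σ : Fin 2)
    (hD : effPartitionFn ℂ (hubbardCovariance L M β μ 0) (hubbardInteraction L M β U) ≠ 0) :
    ‖klSelfEnergy L M β U μ 0 klE0 (nScales β + 1) k σ‖ ≤
      β * (L : ℝ) ^ 2 *
          (|U| *
              ‖gaussExpect ℂ (hubbardCovariance L M β μ 0)
                  (grassmannExp (-(hubbardInteraction L M β U)) *
                    grassmannDeriv ℂ (((k, σ), 0) : HubbardFieldIdx L M)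
                      (grassmannDeriv ℂ (((k, σ), 1) : HubbardFieldIdx L M) (hubbardInteraction L M β 1)))‖ +
            U ^ 2 *
              ‖gaussExpect ℂ (hubbardCovariance L M β μ 0)
                  (grassmannExp (-(hubbardInteraction L M β U)) *
                    (grassmannDeriv ℂ (((k, σ), 0) : HubbardFieldIdx L M) (hubbardInteraction L M β 1) *
                      grassmannDeriv ℂ (((k, σ), 1) : HubbardFieldIdx L M) (hubbardInteraction L M β 1)))‖) /
        ‖effPartitionFn ℂ (hubbardCovariance L M β μ 0) (hubbardInteraction L M β U)‖ := by
  have h := norm_selfEnergy_bare_le_schwingerDyson hβ.ne' U μ k σ hD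
  rw [abs_of_pos hβ] at h
  rw [klSelfEnergy_nScales_succ_eq_selfEnergy_fullActionCT hβ]
  exact h

/-! ## §6 The carrier as «occupation term + six-point insertion» -/

/-- **`Σ̂⁰(k,σ) = U·(βL²)⁻²·Σ_q N(q,σ̄;U)/D + U²·βL²·b(k,σ)/D`** (`D(U) ≠ 0`, `β ≠ 0`): the order-`U` structure is the opposite-spin
occupation sum, the SAME at every external label `k`; all the `k`-dependence sits in the six-point insertion `b(k,σ)`. -/
theorem selfEnergy_fullActionCT_bare_eq_occupation_add {β : ℝ} (hβ : β ≠ 0) (U μ : ℝ) (k : FreqMomentum L M) (σ : Fin 2)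
    (hD : effPartitionFn ℂ (hubbardCovariance L M β μ 0) (hubbardInteraction L M β U) ≠ 0) :
    selfEnergy L M β (fullActionCT L M β U μ 0) k σ =
      (U : ℂ) * (((1 / (β * (L : ℝ) ^ 2) ^ 2 : ℝ) : ℂ)) *
          (∑ q : FreqMomentum L M,
            gaussExpect ℂ (hubbardCovariance L M β μ 0)
              (gen ℂ (((q, 1 - σ), 0) : HubbardFieldIdx L M) * gen ℂ (((q, 1 - σ), 1) : HubbardFieldIdx L M) *
                grassmannExp (-(hubbardInteraction L M β U)))) /
          effPartitionFn ℂ (hubbardCovariance L M β μ 0) (hubbardInteraction L M β U) +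
        (U : ℂ) ^ 2 * ((β * (L : ℝ) ^ 2 : ℝ) : ℂ) *
          gaussExpect ℂ (hubbardCovariance L M β μ 0)
            (grassmannExp (-(hubbardInteraction L M β U)) *
              (grassmannDeriv ℂ (((k, σ), 0) : HubbardFieldIdx L M) (hubbardInteraction L M β 1) *
                grassmannDeriv ℂ (((k, σ), 1) : HubbardFieldIdx L M) (hubbardInteraction L M β 1))) /
          effPartitionFn ℂ (hubbardCovariance L M β μ 0) (hubbardInteraction L M β U) := by
  have hβL : ((β * (L : ℝ) ^ 2 : ℝ) : ℂ) ≠ 0 := by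
    have hL : (L : ℝ) ≠ 0 := by exact_mod_cast NeZero.ne L
    exact_mod_cast mul_ne_zero hβ (pow_ne_zero 2 hL)
  rw [selfEnergy_fullActionCT_bare_eq_schwingerDyson hβ U μ k σ hD, gaussExpect_boltzmann_dd_eq]
  have hr3 : (((1 / (β * (L : ℝ) ^ 2) ^ 3 : ℝ) : ℂ)) = (((β * (L : ℝ) ^ 2 : ℝ) : ℂ) ^ 3)⁻¹ := by push_cast; ring
  have hr2 : (((1 / (β * (L : ℝ) ^ 2) ^ 2 : ℝ) : ℂ)) = (((β * (L : ℝ) ^ 2 : ℝ) : ℂ) ^ 2)⁻¹ := by push_cast; ring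
  rw [hr3, hr2]
  field_simp

end Summit.HubbardSuperconductivity.HubbardSuperconductivity.Theorems.TwoPointAssembly

end
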